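import Mathlib
import Literature.Barriers.ValiantsHypothesis.MonotoneGapParseTrees
import Literature.Barriers.ValiantsHypothesis.MonotoneGapPermanentLower
import Literature.Computability.AlgebraicComplexity.PermanentIrreducible
import Summits.ValiantsHypothesis.ValiantsHypothesis.Theorems.DivisionGapPerMultiplesHardStubAlignedRigidity

/-!
# `DivisionGap.PerMultiplesHard` (stmt-ValiantsHypothesis-5068), line `typed-parse-tree-weights`:
stub `stub_thinCertificate` — the thin certificate

For `n ≥ 3` and a single-typed multiplier `h ∈ ℝ≥0[x_ij]` (every monomial has row margins
`τ.1` and column margins `τ.2`, i.e. `(mapDomain Prod.fst m, mapDomain Prod.snd m) = τ`) we build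
the path certificate `(p, φ)` for `per_n · h` consumed by the line's engine `stub_pathWeightBound`,
of value `#thin(h) · C(n, ⌊n/3⌋) / n!`; `π` is *thin* if some monomial of `h` is supported inside
the graph `{(π j, j)}` of `π`.

* `τg := (𝟙, 𝟙) + τ`: a monomial of `per · h` is `μ_σ + m`, `m ∈ supp h`, and `μ_σ` has all
  margins `1` (`type_of_mem_support_mul`).
* RIGIDITY (`eq_thinMon_of_aligned`): an exponent table with column margins `γ` supported inside
  the graph of `π` IS `thinMon π γ = Σ_j γ j · e_{(π j, j)}`.  So for thin `π` the certificate
  monomial `certMon τ.2 π := μ_π + thinMon π τ.2` lies in `supp (per · h)` (`support_mul_eq` over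
  `ℝ≥0`), and `π ↦ certMon τ.2 π` is injective.
* `p :=` indicator of `T := certMon τ.2 '' thin` (`Σ_{supp (per h)} p = |T| = #thin`),
  `W := C(n, ⌊n/3⌋) / n!`, `φ τ' := W · [2n < 3 |supp τ'.1|]`; `φ 0 = 0`, `φ (single) = 0`,
  `φ τg = W`, so the value inequality holds with equality.
* JUMP CONSTRAINT (`jump_le_one`): `φ(τ₁+τ₂) - max (φ τ₁) (φ τ₂) ≤ 0` unless it is `W` and (by
  `supp (f+g) ⊆ supp f ∪ supp g`) one of `τ₁, τ₂` — symmetric — has row support `k`, `n < 3k ≤ 2n`.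
  If `a + b + c = certMon τ.2 π`, `a ∈ A` (type `τ₁`), `b ∈ B` (type `τ₂`), then by rigidity
  `a = thinMon π τ₁.2`, `b = thinMon π τ₂.2`, `c = certMon τ.2 π - (a + b)` and `π` is served by
  `A` (`filter_triples_subset`); the sibling stub's `AlignedRigidity.card_served_le_factorial`
  gives `≤ k! (n-k)!` served permutations, and `k! (n-k)! · C(n, ⌊n/3⌋) ≤ n!` in the window.

Log (stub-worker): `φ` is keyed on ROW support, so the count is literally the sibling's
`card_served_le_factorial`; `A + B + C ⊆ supp (per · h)` is not needed (`p` vanishes off `T`).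
-/

noncomputable section

open MvPolynomial Literature.Computability.AlgebraicComplexity
open scoped NNReal BigOperators

namespace Summit.ValiantsHypothesis.ValiantsHypothesis.Theorems.DivisionGap.PerMultiplesHard.ThinCertificate

variable {n : ℕ}

/-- The row margins `mapDomain Prod.fst m` of an exponent table `m`, entrywise: the `i`-th entry
is the `i`-th row sum. [folklore] -/
theorem mapDomain_fst_apply (m : (Fin n × Fin n) →₀ ℕ) (i : Fin n) :
    Finsupp.mapDomain Prod.fst m i = ∑ j, m (i, j) := by
  classical
  rw [Finsupp.mapDomain, Finsupp.sum_fintype _ _ (fun _ => Finsupp.single_zero _),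
    Finsupp.finsetSum_apply, Fintype.sum_prod_type]
  simp only [Finsupp.single_apply]
  rw [Finset.sum_eq_single i (fun i' _ hi' => by simp [hi']) (by simp)]
  simp

/-- The column margins `mapDomain Prod.snd m` of an exponent table `m`, entrywise: the `j`-th
entry is the `j`-th column sum. [folklore] -/
theorem mapDomain_snd_apply (m : (Fin n × Fin n) →₀ ℕ) (j : Fin n) :
    Finsupp.mapDomain Prod.snd m j = ∑ i, m (i, j) := by
  classical
  rw [Finsupp.mapDomain, Finsupp.sum_fintype _ _ (fun _ => Finsupp.single_zero _),
    Finsupp.finsetSum_apply, Fintype.sum_prod_type, Finset.sum_comm]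
  simp only [Finsupp.single_apply]
  rw [Finset.sum_eq_single j (fun j' _ hj' => by simp [hj']) (by simp)]
  simp

/-- The all-ones margin vector `𝟙 : Fin n →₀ ℕ`, the common row (and column) type of every
permutation monomial. [folklore] -/
def ones (n : ℕ) : Fin n →₀ ℕ := Finsupp.equivFunOnFinite.symm fun _ => 1

/-- `𝟙 i = 1`. [folklore] -/
@[simp] theorem ones_apply (i : Fin n) : ones n i = 1 := rfl

/-- A permutation monomial has row type `𝟙` (one variable in each row). [folklore] -/
theorem mapDomain_fst_permMonomial (σ : Equiv.Perm (Fin n)) :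
    Finsupp.mapDomain Prod.fst (permMonomial σ) = ones n := by
  ext i
  rw [mapDomain_fst_apply, ones_apply]
  exact rowCount_permMonomial σ i

/-- A permutation monomial has column type `𝟙` (one variable in each column). [folklore] -/
theorem mapDomain_snd_permMonomial (σ : Equiv.Perm (Fin n)) :
    Finsupp.mapDomain Prod.snd (permMonomial σ) = ones n := by
  ext j
  rw [mapDomain_snd_apply, ones_apply]
  exact colCount_permMonomial σ j

/-! ### Thin monomials and rigidity -/

/-- The exponent table supported inside the graph `{(π j, j)}` of `π` whose entry in column `j`
is `γ j`: `thinMon π γ = Σ_j γ j · e_{(π j, j)}`. [folklore] -/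
def thinMon (π : Equiv.Perm (Fin n)) (γ : Fin n →₀ ℕ) : (Fin n × Fin n) →₀ ℕ :=
  Finsupp.equivFunOnFinite.symm fun e => if π e.2 = e.1 then γ e.2 else 0

/-- `thinMon π γ (i, j) = [π j = i] · γ j`. [folklore] -/
@[simp] theorem thinMon_apply (π : Equiv.Perm (Fin n)) (γ : Fin n →₀ ℕ) (e : Fin n × Fin n) :
    thinMon π γ e = if π e.2 = e.1 then γ e.2 else 0 := rfl

-- adapted from `ThinPatterns.apply_eq_of_aligned` (constant column sums there, a column type here)
/-- **Rigidity.** An exponent table with column margins `γ` supported inside the graph of `π`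
is `thinMon π γ`: in column `j` its only possibly nonzero cell is `(π j, j)`, which therefore
carries the whole column sum `γ j`. [folklore] -/
theorem eq_thinMon_of_aligned {π : Equiv.Perm (Fin n)} {γ : Fin n →₀ ℕ}
    {m : (Fin n × Fin n) →₀ ℕ} (hcol : Finsupp.mapDomain Prod.snd m = γ)
    (hal : ∀ e : Fin n × Fin n, m e ≠ 0 → π e.2 = e.1) : m = thinMon π γ := by
  ext ⟨i, j⟩
  rw [thinMon_apply]
  have hzero : ∀ i', π j ≠ i' → m (i', j) = 0 := fun i' hi' => by
    by_contra hne; exact hi' (hal (i', j) hne)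
  split_ifs with hij
  · rw [← hcol, mapDomain_snd_apply, Finset.sum_eq_single i]
    · intro i' _ hi'
      exact hzero i' (fun h => hi' (h.symm.trans hij))
    · simp
  · exact hzero i hij

/-- The certificate monomial of a thin permutation `π` for a multiplier of column type `τ2`:
`μ_π + thinMon π τ2` (the permutation monomial of `π` plus the unique monomial of the multiplier
inside the graph of `π`). [folklore] -/
def certMon (τ2 : Fin n →₀ ℕ) (π : Equiv.Perm (Fin n)) : (Fin n × Fin n) →₀ ℕ :=
  permMonomial π + thinMon π τ2

/-- `certMon τ2 π (i, j) = [π j = i] · (τ2 j + 1)`. [folklore] -/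
theorem certMon_apply (τ2 : Fin n →₀ ℕ) (π : Equiv.Perm (Fin n)) (e : Fin n × Fin n) :
    certMon τ2 π e = if π e.2 = e.1 then τ2 e.2 + 1 else 0 := by
  obtain ⟨i, j⟩ := e
  simp only [certMon, Finsupp.add_apply, permMonomial_apply, thinMon_apply]
  split_ifs <;> omega

/-- Anything below `certMon τ2 π` is supported inside the graph of `π`. [folklore] -/
theorem aligned_of_le_certMon {τ2 : Fin n →₀ ℕ} {π : Equiv.Perm (Fin n)}
    {a : (Fin n × Fin n) →₀ ℕ} (ha : a ≤ certMon τ2 π) :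
    ∀ e : Fin n × Fin n, a e ≠ 0 → π e.2 = e.1 := by
  intro e he
  by_contra hne
  have h := ha e
  rw [certMon_apply, if_neg hne] at h; omega

/-- `π ↦ certMon τ2 π` is injective (its support is the graph of `π`). [folklore] -/
theorem certMon_injective (τ2 : Fin n →₀ ℕ) : Function.Injective (certMon (n := n) τ2) := by
  intro π π' h
  refine Equiv.ext fun j => ?_
  have h1 := DFunLike.congr_fun h (π j, j)
  rw [certMon_apply, certMon_apply, if_pos rfl] at h1
  by_contra hne
  rw [if_neg (fun h' => hne h'.symm)] at h1
  omega

/-- For a thin `π` (some monomial of the single-typed `h` lies inside the graph of `π`) the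
certificate monomial `certMon τ.2 π` is a monomial of `per_n · h`: the monomial of `h` inside the
graph is `thinMon π τ.2` by rigidity, and over `ℝ≥0` supports of products are sumsets
(`JerrumSnir.support_mul_eq`). [folklore] -/
theorem certMon_mem_support {h : MvPolynomial (Fin n × Fin n) ℝ≥0} {τ : (Fin n →₀ ℕ) × (Fin n →₀ ℕ)}
    (hτ : ∀ m ∈ h.support, (Finsupp.mapDomain Prod.fst m, Finsupp.mapDomain Prod.snd m) = τ)
    {π : Equiv.Perm (Fin n)} (hπ : ∃ m ∈ h.support, ∀ e : Fin n × Fin n, m e ≠ 0 → π e.2 = e.1) :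
    certMon τ.2 π ∈ (perPoly (Fin n) ℝ≥0 * h).support := by
  classical
  obtain ⟨m, hm, hal⟩ := hπ
  have hmeq : m = thinMon π τ.2 := eq_thinMon_of_aligned (congrArg Prod.snd (hτ m hm)) hal
  rw [Literature.Barriers.ValiantsHypothesis.JerrumSnir.support_mul_eq, certMon, ← hmeq]
  exact Finset.add_mem_add
    ((Literature.Barriers.ValiantsHypothesis.JerrumSnir.mem_support_perPoly ℝ≥0).mpr ⟨π, rfl⟩) hm

/-- `per_n · h` is single-typed of type `(𝟙, 𝟙) + τ` when `h` is single-typed of type `τ`: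
every monomial of the product is `μ_σ + m` with `m ∈ supp h`, and types are additive.
[folklore] -/
theorem type_of_mem_support_mul {h : MvPolynomial (Fin n × Fin n) ℝ≥0} {τ : (Fin n →₀ ℕ) × (Fin n →₀ ℕ)}
    (hτ : ∀ m ∈ h.support, (Finsupp.mapDomain Prod.fst m, Finsupp.mapDomain Prod.snd m) = τ)
    {m : (Fin n × Fin n) →₀ ℕ} (hm : m ∈ (perPoly (Fin n) ℝ≥0 * h).support) :
    (Finsupp.mapDomain Prod.fst m, Finsupp.mapDomain Prod.snd m) = (ones n, ones n) + τ := by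
  classical
  obtain ⟨u, hu, v, hv, rfl⟩ := Finset.mem_add.mp (MvPolynomial.support_mul _ _ hm)
  obtain ⟨σ, rfl⟩ :=
    (Literature.Barriers.ValiantsHypothesis.JerrumSnir.mem_support_perPoly ℝ≥0).mp hu
  rw [← hτ v hv, Prod.mk_add_mk, Finsupp.mapDomain_add, Finsupp.mapDomain_add,
    mapDomain_fst_permMonomial, mapDomain_snd_permMonomial]

/-! ### The jump constraint: triples summing into `T` are served permutations -/

/-- **Key rigidity count.** If `a ∈ A` (type `τ₁`), `b ∈ B` (type `τ₂`) and
`a + b + c = certMon τ2 π`, then `a = thinMon π τ₁.2`, `b = thinMon π τ₂.2`,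
`c = certMon τ2 π - (a + b)`, and `π` is served by `A` (some element of `A` is supported inside
the graph of `π`): the triples of `A × B × C` summing into `certMon τ2 '' Th` lie in the image of
the served permutations under an explicit map. [folklore] -/
theorem filter_triples_subset (τ2 : Fin n →₀ ℕ) (Th : Finset (Equiv.Perm (Fin n)))
    (A B C : Finset ((Fin n × Fin n) →₀ ℕ)) (τ₁ τ₂ : (Fin n →₀ ℕ) × (Fin n →₀ ℕ))
    (hA : ∀ a ∈ A, (Finsupp.mapDomain Prod.fst a, Finsupp.mapDomain Prod.snd a) = τ₁)
    (hB : ∀ b ∈ B, (Finsupp.mapDomain Prod.fst b, Finsupp.mapDomain Prod.snd b) = τ₂) :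
    ((A ×ˢ (B ×ˢ C)).filter fun x => x.1 + x.2.1 + x.2.2 ∈ Th.image (certMon τ2)) ⊆
      (Finset.univ.filter fun π : Equiv.Perm (Fin n) =>
          ∃ B ∈ A, ∀ e ∈ B.support, e.1 = π e.2).image
        fun π => (thinMon π τ₁.2, thinMon π τ₂.2,
          certMon τ2 π - (thinMon π τ₁.2 + thinMon π τ₂.2)) := by
  intro x hx
  obtain ⟨hx, hT⟩ := Finset.mem_filter.mp hx
  obtain ⟨ha, hbc⟩ := Finset.mem_product.mp hx
  obtain ⟨hb, -⟩ := Finset.mem_product.mp hbc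
  obtain ⟨π, -, hπ⟩ := Finset.mem_image.mp hT
  have hal_a : ∀ e : Fin n × Fin n, x.1 e ≠ 0 → π e.2 = e.1 :=
    aligned_of_le_certMon (τ2 := τ2) (by rw [hπ]; exact le_add_right le_self_add)
  have hal_b : ∀ e : Fin n × Fin n, x.2.1 e ≠ 0 → π e.2 = e.1 :=
    aligned_of_le_certMon (τ2 := τ2) (by rw [hπ]; exact le_add_right le_add_self)
  have ha_eq : x.1 = thinMon π τ₁.2 := eq_thinMon_of_aligned (congrArg Prod.snd (hA _ ha)) hal_a
  have hb_eq : x.2.1 = thinMon π τ₂.2 :=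
    eq_thinMon_of_aligned (congrArg Prod.snd (hB _ hb)) hal_b
  have hc_eq : x.2.2 = certMon τ2 π - (thinMon π τ₁.2 + thinMon π τ₂.2) := by
    rw [← ha_eq, ← hb_eq, hπ, add_tsub_cancel_left]
  refine Finset.mem_image.mpr
    ⟨π, Finset.mem_filter.mpr ⟨Finset.mem_univ _, x.1, ha, fun e he => ?_⟩, ?_⟩
  · exact (hal_a e (Finsupp.mem_support_iff.mp he)).symm
  · exact Prod.ext ha_eq.symm (Prod.ext hb_eq.symm hc_eq.symm)

/-- The number of triples of `A × B × C` (types `τ₁`, `τ₂` on `A`, `B`) summing into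
`certMon τ2 '' Th` is at most the number of permutations served by `A`. [folklore] -/
theorem sum_indicator_le_card_served (τ2 : Fin n →₀ ℕ) (Th : Finset (Equiv.Perm (Fin n)))
    (A B C : Finset ((Fin n × Fin n) →₀ ℕ)) (τ₁ τ₂ : (Fin n →₀ ℕ) × (Fin n →₀ ℕ))
    (hA : ∀ a ∈ A, (Finsupp.mapDomain Prod.fst a, Finsupp.mapDomain Prod.snd a) = τ₁)
    (hB : ∀ b ∈ B, (Finsupp.mapDomain Prod.fst b, Finsupp.mapDomain Prod.snd b) = τ₂) :
    (∑ a ∈ A, ∑ b ∈ B, ∑ c ∈ C,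
        if a + b + c ∈ Th.image (certMon τ2) then (1 : ℝ) else 0) ≤
      ((Finset.univ.filter fun π : Equiv.Perm (Fin n) =>
          ∃ B ∈ A, ∀ e ∈ B.support, e.1 = π e.2).card : ℝ) := by
  have hS : (∑ a ∈ A, ∑ b ∈ B, ∑ c ∈ C,
      if a + b + c ∈ Th.image (certMon τ2) then (1 : ℝ) else 0) =
      ∑ x ∈ A ×ˢ (B ×ˢ C),
        if x.1 + x.2.1 + x.2.2 ∈ Th.image (certMon τ2) then (1 : ℝ) else 0 := by
    rw [Finset.sum_product]
    refine Finset.sum_congr rfl fun a _ => ?_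
    rw [Finset.sum_product]
  rw [hS, Finset.sum_boole]
  exact_mod_cast (Finset.card_le_card (filter_triples_subset τ2 Th A B C τ₁ τ₂ hA hB)).trans
    Finset.card_image_le

/-- A typed set `A` (type `τ₁`) serves at most `k! (n-k)!` permutations, `k` the row support of
`τ₁` — the sibling stub's `AlignedRigidity.card_served_le_factorial`, with the margins read off
`mapDomain`. [folklore] -/
theorem card_served_le (A : Finset ((Fin n × Fin n) →₀ ℕ)) (τ₁ : (Fin n →₀ ℕ) × (Fin n →₀ ℕ))
    (hA : ∀ a ∈ A, (Finsupp.mapDomain Prod.fst a, Finsupp.mapDomain Prod.snd a) = τ₁) :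
    (Finset.univ.filter fun π : Equiv.Perm (Fin n) =>
        ∃ B ∈ A, ∀ e ∈ B.support, e.1 = π e.2).card ≤
      τ₁.1.support.card.factorial * (n - τ₁.1.support.card).factorial := by
  have hS : ∀ m ∈ A, (∀ i, ∑ j, m (i, j) = τ₁.1 i) ∧ (∀ j, ∑ i, m (i, j) = τ₁.2 j) := by
    intro m hm
    have h1 : Finsupp.mapDomain Prod.fst m = τ₁.1 := by rw [← hA m hm]
    have h2 : Finsupp.mapDomain Prod.snd m = τ₁.2 := by rw [← hA m hm]
    exact ⟨fun i => by rw [← mapDomain_fst_apply, h1], fun j => by rw [← mapDomain_snd_apply, h2]⟩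
  have key := AlignedRigidity.card_served_le_factorial A (⇑τ₁.1) (⇑τ₁.2) hS
  have hZ : (Finset.univ.filter fun i => τ₁.1 i ≠ 0) = τ₁.1.support := by ext i; simp
  rw [hZ, Fintype.card_fin] at key
  exact key

/-- The window arithmetic: `k! (n-k)! · C(n, ⌊n/3⌋) ≤ n!` for `n < 3k ≤ 2n`, since
`k! (n-k)! · C(n, k) = n!` and `C(n, ⌊n/3⌋) ≤ C(n, k)` for `⌊n/3⌋ ≤ k ≤ n - ⌊n/3⌋`
(unimodality of the binomial coefficients). [folklore] -/
theorem factorial_mul_factorial_mul_choose_le {n k : ℕ} (hlo : n < 3 * k) (hhi : 3 * k ≤ 2 * n) :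
    k.factorial * (n - k).factorial * n.choose (n / 3) ≤ n.factorial := by
  have hkn : k ≤ n := by omega
  have hc : n.choose (n / 3) ≤ n.choose k :=
    Literature.GroupTheory.PermutationGroups.choose_le_choose_of_le_of_le_sub
      (by omega) (by omega) hkn
  calc k.factorial * (n - k).factorial * n.choose (n / 3)
      ≤ k.factorial * (n - k).factorial * n.choose k := Nat.mul_le_mul_left _ hc
    _ = n.choose k * k.factorial * (n - k).factorial := by ring
    _ = n.factorial := Nat.choose_mul_factorial_mul_factorial hkn

/-- **The jump constraint in the charged case.** If `A` has type `τ₁` with row support `k` in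
the window `n < 3k ≤ 2n` (and `B` has some type `τ₂`), then
`C(n, ⌊n/3⌋) / n! · #{(a, b, c) ∈ A × B × C | a + b + c ∈ certMon τ2 '' Th} ≤ 1`:
the count is at most the number `≤ k! (n-k)!` of permutations served by `A`, and
`k! (n-k)! · C(n, ⌊n/3⌋) ≤ n!`. [folklore] -/
theorem jump_le_one {τ2 : Fin n →₀ ℕ} {Th : Finset (Equiv.Perm (Fin n))}
    (A B C : Finset ((Fin n × Fin n) →₀ ℕ)) (τ₁ τ₂ : (Fin n →₀ ℕ) × (Fin n →₀ ℕ))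
    (hA : ∀ a ∈ A, (Finsupp.mapDomain Prod.fst a, Finsupp.mapDomain Prod.snd a) = τ₁)
    (hB : ∀ b ∈ B, (Finsupp.mapDomain Prod.fst b, Finsupp.mapDomain Prod.snd b) = τ₂)
    (hlo : n < 3 * τ₁.1.support.card) (hhi : 3 * τ₁.1.support.card ≤ 2 * n) :
    (n.choose (n / 3) : ℝ) / n.factorial *
      (∑ a ∈ A, ∑ b ∈ B, ∑ c ∈ C,
        if a + b + c ∈ Th.image (certMon τ2) then (1 : ℝ) else 0) ≤ 1 := by
  set k := τ₁.1.support.card with hk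
  have h1 := sum_indicator_le_card_served τ2 Th A B C τ₁ τ₂ hA hB
  have h2 : ((Finset.univ.filter fun π : Equiv.Perm (Fin n) =>
      ∃ B ∈ A, ∀ e ∈ B.support, e.1 = π e.2).card : ℝ) ≤
      ((k.factorial * (n - k).factorial : ℕ) : ℝ) := by
    exact_mod_cast card_served_le A τ₁ hA
  have h3 : ((k.factorial * (n - k).factorial : ℕ) : ℝ) * n.choose (n / 3) ≤ n.factorial := by
    exact_mod_cast factorial_mul_factorial_mul_choose_le hlo hhi
  have hfac : (0 : ℝ) < n.factorial := by exact_mod_cast Nat.factorial_pos n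
  rw [div_mul_eq_mul_div, div_le_one hfac]
  calc (n.choose (n / 3) : ℝ) * _
      ≤ (n.choose (n / 3) : ℝ) * ((k.factorial * (n - k).factorial : ℕ) : ℝ) :=
        mul_le_mul_of_nonneg_left (h1.trans h2) (Nat.cast_nonneg _)
    _ ≤ n.factorial := by rw [mul_comm]; exact h3

/-! ### The stub -/

/-- **S3 `stub_thinCertificate` (the thin certificate).**  For `n ≥ 3` and a single-typed
multiplier `h` of type `τ`, the target `per_n · h` (single-typed of type `τg = (𝟙, 𝟙) + τ`)
carries a path certificate `(p, φ)` of value `(Σ_{supp (per h)} p) · φ τg ≥ #thin(h) · C(n, ⌊n/3⌋)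
/ n!`: `p` the indicator of the thin certificate monomials `μ_π + thinMon π τ.2`,
`φ = W · [3 |row support| > 2n]`, `W = C(n, ⌊n/3⌋) / n!`; feasibility by rigidity of thin
monomials and the served-permutation count `k! (n-k)! ≤ n! / C(n, ⌊n/3⌋)`. [folklore] -/
theorem stub_thinCertificate :
    ∀ (n : ℕ), 3 ≤ n → ∀ (h : MvPolynomial (Fin n × Fin n) NNReal) (τ : (Fin n →₀ ℕ) × (Fin n →₀ ℕ)),
      (∀ m ∈ h.support, (Finsupp.mapDomain Prod.fst m, Finsupp.mapDomain Prod.snd m) = τ) →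
      ∃ (τg : (Fin n →₀ ℕ) × (Fin n →₀ ℕ)) (p : ((Fin n × Fin n) →₀ ℕ) → ℝ)
        (φ : (Fin n →₀ ℕ) × (Fin n →₀ ℕ) → ℝ),
        (∀ m ∈ (Literature.Computability.AlgebraicComplexity.perPoly (Fin n) NNReal * h).support,
          (Finsupp.mapDomain Prod.fst m, Finsupp.mapDomain Prod.snd m) = τg) ∧
        (∀ m, 0 ≤ p m) ∧ φ 0 ≤ 0 ∧
        (∀ e : Fin n × Fin n, φ (Finsupp.single e.1 1, Finsupp.single e.2 1) ≤ 0) ∧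
        (∀ (A B C : Finset ((Fin n × Fin n) →₀ ℕ)) (τ₁ τ₂ : (Fin n →₀ ℕ) × (Fin n →₀ ℕ)),
          (∀ a ∈ A, (Finsupp.mapDomain Prod.fst a, Finsupp.mapDomain Prod.snd a) = τ₁) →
          (∀ b ∈ B, (Finsupp.mapDomain Prod.fst b, Finsupp.mapDomain Prod.snd b) = τ₂) →
          (∀ a ∈ A, ∀ b ∈ B, ∀ c ∈ C, a + b + c ∈
            (Literature.Computability.AlgebraicComplexity.perPoly (Fin n) NNReal * h).support) →
          (φ (τ₁ + τ₂) - max (φ τ₁) (φ τ₂)) * (∑ a ∈ A, ∑ b ∈ B, ∑ c ∈ C, p (a + b + c)) ≤ 1) ∧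
        ((((Finset.univ : Finset (Equiv.Perm (Fin n))).filter (fun π =>
            ∃ m ∈ h.support, ∀ e : Fin n × Fin n, m e ≠ 0 → π e.2 = e.1)).card : ℕ) : ℝ) *
            (n.choose (n / 3) : ℝ) ≤
          (n.factorial : ℝ) *
            ((∑ m ∈ (Literature.Computability.AlgebraicComplexity.perPoly (Fin n) NNReal * h).support,
                p m) * φ τg) := by
  intro n hn h τ hτ
  -- the thin permutations `Th`, the certificate monomials `T`, the weight `W`
  set Th : Finset (Equiv.Perm (Fin n)) := (Finset.univ : Finset (Equiv.Perm (Fin n))).filter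
    (fun π => ∃ m ∈ h.support, ∀ e : Fin n × Fin n, m e ≠ 0 → π e.2 = e.1) with hTh
  set T : Finset ((Fin n × Fin n) →₀ ℕ) := Th.image (certMon τ.2) with hT
  set W : ℝ := (n.choose (n / 3) : ℝ) / n.factorial with hW
  have hW0 : 0 ≤ W := by positivity
  have hTsub : T ⊆ (perPoly (Fin n) ℝ≥0 * h).support := fun M hM => by
    obtain ⟨π, hπ, rfl⟩ := Finset.mem_image.mp hM
    exact certMon_mem_support hτ (Finset.mem_filter.mp hπ).2
  refine ⟨(ones n, ones n) + τ, fun m => if m ∈ T then 1 else 0,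
    fun τ' => if 2 * n < 3 * τ'.1.support.card then W else 0, ?_, ?_, ?_, ?_, ?_, ?_⟩
  · -- the target `per · h` is single-typed of type `(𝟙, 𝟙) + τ`
    exact fun m hm => type_of_mem_support_mul hτ hm
  · -- `p ≥ 0`
    intro m
    dsimp only; split_ifs <;> norm_num
  · -- `φ 0 ≤ 0`
    dsimp only; rw [if_neg (by simp)]
  · -- `φ` vanishes on single variables (`3 ≤ 2n`)
    intro e
    dsimp only
    rw [if_neg (by rw [Finsupp.support_single _ one_ne_zero, Finset.card_singleton]; omega)]
  · -- the jump constraint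
    intro A B C τ₁ τ₂ hA hB _
    dsimp only
    set S := ∑ a ∈ A, ∑ b ∈ B, ∑ c ∈ C, if a + b + c ∈ T then (1 : ℝ) else 0 with hS
    have hSnn : 0 ≤ S := Finset.sum_nonneg fun a _ => Finset.sum_nonneg fun b _ =>
      Finset.sum_nonneg fun c _ => by split_ifs <;> norm_num
    have hle12 : (if 2 * n < 3 * (τ₁ + τ₂).1.support.card then W else 0) ≤ W := by
      split_ifs <;> linarith
    by_cases h1 : 2 * n < 3 * τ₁.1.support.card
    · rw [if_pos h1]
      refine le_trans (mul_nonpos_of_nonpos_of_nonneg ?_ hSnn) zero_le_one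
      linarith [le_max_left W (if 2 * n < 3 * τ₂.1.support.card then W else 0)]
    by_cases h2 : 2 * n < 3 * τ₂.1.support.card
    · rw [if_pos h2]
      refine le_trans (mul_nonpos_of_nonpos_of_nonneg ?_ hSnn) zero_le_one
      linarith [le_max_right (if 2 * n < 3 * τ₁.1.support.card then W else 0) W]
    rw [if_neg h1, if_neg h2, max_self, sub_zero]
    by_cases h12 : 2 * n < 3 * (τ₁ + τ₂).1.support.card
    swap
    · rw [if_neg h12, zero_mul]; exact zero_le_one
    rw [if_pos h12]
    have hunion : (τ₁ + τ₂).1.support.card ≤ τ₁.1.support.card + τ₂.1.support.card := by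
      rw [Prod.fst_add]
      exact (Finset.card_le_card Finsupp.support_add).trans (Finset.card_union_le _ _)
    rcases (show n < 3 * τ₁.1.support.card ∨ n < 3 * τ₂.1.support.card by omega) with hk | hk
    · exact jump_le_one A B C τ₁ τ₂ hA hB hk (by omega)
    · have hswap : S = ∑ b ∈ B, ∑ a ∈ A, ∑ c ∈ C, if b + a + c ∈ T then (1 : ℝ) else 0 := by
        rw [hS, Finset.sum_comm]
        refine Finset.sum_congr rfl fun b _ => Finset.sum_congr rfl fun a _ =>
          Finset.sum_congr rfl fun c _ => ?_
        rw [add_comm a b]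
      rw [hswap]
      exact jump_le_one B A C τ₂ τ₁ hB hA hk (by omega)
  · -- the value: `#thin · C(n, ⌊n/3⌋) = n! · (|T| · W)`
    dsimp only
    have hsum : (∑ m ∈ (perPoly (Fin n) ℝ≥0 * h).support, if m ∈ T then (1 : ℝ) else 0) =
        (Th.card : ℝ) := by
      rw [Finset.sum_boole, Finset.filter_mem_eq_inter, Finset.inter_eq_right.mpr hTsub, hT,
        Finset.card_image_of_injective _ (certMon_injective τ.2)]
    have hfull : ((ones n, ones n) + τ).1.support = Finset.univ := by
      ext i; simp [Prod.fst_add, Finsupp.mem_support_iff]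
    rw [hsum, hfull, Finset.card_univ, Fintype.card_fin, if_pos (by omega), hW]
    have hfac : (n.factorial : ℝ) ≠ 0 := by exact_mod_cast Nat.factorial_ne_zero n
    refine le_of_eq ?_
    field_simp

end Summit.ValiantsHypothesis.ValiantsHypothesis.Theorems.DivisionGap.PerMultiplesHard.ThinCertificate

end
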